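import Mathlib
import HarnessLib
import Summits.AtomisticToContinuum.FouriersLaw.Theorems.JunctionLocalityConductanceLowerBoundStubShortTimeDipoleFloorAux6
import Summits.AtomisticToContinuum.FouriersLaw.Theorems.JunctionLocalityConductanceLowerBoundStubShortTimeDipoleFloorAux12
import Literature.MathematicalPhysics.KineticTheory.LangevinChainExpMartingale
import Literature.Probability.Process.BrownianSupTail

/-!
# Short-time dipole floor, helper 14: tools for the time continuity at the contact bond

Helper (`--supports stmt-AtomisticToContinuum-11749`) for stub `stub_shortTimeDipoleFloor` (S) of line
`kick-dipole-no-collapse`, crux `JunctionLocality.ConductanceLowerBound`.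

The contact bond `(0, 1)` is the only bond whose current pairs with the contact power `a₀ = p_0 ∂_{q_0}H` at time `0`; its
contribution to the contact power pairing is continuous at `s = 0` UNIFORMLY IN `N` because the flow moves every single site by
`O(√s)` in `L²(μ_T ⊗ W)` with local constants.  This file supplies the three inputs of that displacement bound:

* `abs_drift_snd_le_local`, `drift_snd_sq_le_local`, `integral_drift_snd_sq_le` — the momentum drift `Y(z)_{p,m}` is dominated
  by local monomials of the (at most three) sites around `m`, hence `∫ Y_{p,m}² dμ_T^N ≤ C_Y` uniformly in `N` and `m`
  (factorial Gibbs moments of helper 8);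
* `lintegral_sq_timeIntegral_comp_solMap_le` — Jensen in time + Tonelli + stationarity:
  `∫⁻ (∫₀ᵗ g(Φ_r x) dr)² d(μ_T ⊗ W) ≤ t² ∫ g² dμ_T` for continuous `g ≥ 0`;
* `lintegral_pairNoise_sq_le` — the driving noise of one site over `[0, s]` has `∫⁻ η_m(s)² d(μ_T ⊗ W) ≤ 8 γ T s`.
-/

noncomputable section

open MeasureTheory ProbabilityTheory Set Filter Topology Finset
open scoped NNReal ENNReal

namespace Summit.AtomisticToContinuum.FouriersLaw.Cruxes.ConductanceLowerBound.KickDipoleNoCollapse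

open Literature.MathematicalPhysics.KineticTheory Literature.MathematicalPhysics.KineticTheory.HeatConduction
open Literature.Probability.Process OscillatorChain
open Summit.AtomisticToContinuum.FouriersLaw.Theorems
open Summit.AtomisticToContinuum.FouriersLaw.Theorems.NonBallistic

variable {N : ℕ} {ω₂ lam β γ : ℝ}

/-! ### The momentum drift is dominated by local monomials -/

/-- The drift vanishes at the origin of phase space (momentum components). -/
theorem drift_snd_zero (m : Fin N) : ((pinnedChain ω₂ lam β γ).drift N 0).2 m = 0 := by
  rw [pinnedChain_drift_apply]
  simp [OscillatorChain.dPotential_eq_closed, pinnedChain_deriv_U, pinnedChain_deriv_V]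

/-- **Local bound of the momentum drift**: `|Y(z)_{p,m}| ≤ (K₁ + 2γ) W_m D_m` with the neighbourhood sums
`W_m = Σ_{|l−m|≤1} (1 + q_l²)`, `D_m = Σ_{|l−m|≤1} (|q_l| + |p_l|)` and `K₁ = ω₂ + 2 lam + 8(1 + 2β)`. -/
theorem abs_drift_snd_le_local (hω : 0 ≤ ω₂) (hl : 0 ≤ lam) (hβ : 0 ≤ β) (hγ : 0 ≤ γ) (z : PhaseSpace N) (m : Fin N) :
    |((pinnedChain ω₂ lam β γ).drift N z).2 m| ≤
      (ω₂ + 2 * lam + 8 * (1 + 2 * β) + 2 * γ) *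
        (∑ l : Fin N, if l.val ≤ m.val + 1 ∧ m.val ≤ l.val + 1 then (1 + z.1 l ^ 2) else 0) *
        (∑ l : Fin N, if l.val ≤ m.val + 1 ∧ m.val ≤ l.val + 1 then (|z.1 l| + |z.2 l|) else 0) := by
  set K₁ : ℝ := ω₂ + 2 * lam + 8 * (1 + 2 * β) with hK₁
  set W : ℝ := ∑ l : Fin N, if l.val ≤ m.val + 1 ∧ m.val ≤ l.val + 1 then (1 + z.1 l ^ 2) else 0 with hW
  set D : ℝ := ∑ l : Fin N, if l.val ≤ m.val + 1 ∧ m.val ≤ l.val + 1 then (|z.1 l| + |z.2 l|) else 0 with hD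
  have h := abs_drift_snd_sub_le_local hω hl hβ hγ (0 : PhaseSpace N) z (d := fun l => |z.1 l| + |z.2 l|)
    (fun j => by positivity) (fun j => by simp) (fun j => by simp) m
  rw [drift_snd_zero, sub_zero] at h
  have hW' : (∑ l : Fin N, if l.val ≤ m.val + 1 ∧ m.val ≤ l.val + 1 then
      (1 + (0 : PhaseSpace N).1 l ^ 2 + z.1 l ^ 2) else 0) = W := by
    refine Finset.sum_congr rfl fun l _ => ?_
    split_ifs <;> simp
  rw [hW'] at h
  have hmm : m.val ≤ m.val + 1 ∧ m.val ≤ m.val + 1 := ⟨Nat.le_succ _, Nat.le_succ _⟩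
  have hW1 : 1 ≤ W := by
    have h1 := Finset.single_le_sum
      (f := fun l : Fin N => if l.val ≤ m.val + 1 ∧ m.val ≤ l.val + 1 then (1 + z.1 l ^ 2) else 0)
      (fun l _ => by split_ifs <;> positivity) (Finset.mem_univ m)
    simp only [hmm, and_self, if_true] at h1
    nlinarith [sq_nonneg (z.1 m)]
  have hdD : |z.1 m| + |z.2 m| ≤ D := by
    have h1 := Finset.single_le_sum
      (f := fun l : Fin N => if l.val ≤ m.val + 1 ∧ m.val ≤ l.val + 1 then (|z.1 l| + |z.2 l|) else 0)
      (fun l _ => by split_ifs <;> positivity) (Finset.mem_univ m)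
    simpa [hmm] using h1
  have hD0 : 0 ≤ D := le_trans (by positivity) hdD
  have hK₁0 : 0 ≤ K₁ := by positivity
  calc |((pinnedChain ω₂ lam β γ).drift N z).2 m| ≤ K₁ * W * D + 2 * γ * (|z.1 m| + |z.2 m|) := h
    _ ≤ K₁ * W * D + 2 * γ * (W * D) := by
        gcongr
        calc |z.1 m| + |z.2 m| ≤ D := hdD
          _ = 1 * D := (one_mul D).symm
          _ ≤ W * D := mul_le_mul_of_nonneg_right hW1 hD0
    _ = (K₁ + 2 * γ) * W * D := by ring

/-- **The squared momentum drift is dominated by local monomials**: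
`Y(z)_{p,m}² ≤ 324 (K₁ + 2γ)² Σ_{|l−m|≤1} (1 + q_l⁸ + q_l⁴ + p_l⁴)`. -/
theorem drift_snd_sq_le_local (hω : 0 ≤ ω₂) (hl : 0 ≤ lam) (hβ : 0 ≤ β) (hγ : 0 ≤ γ) (z : PhaseSpace N) (m : Fin N) :
    ((pinnedChain ω₂ lam β γ).drift N z).2 m ^ 2 ≤
      324 * (ω₂ + 2 * lam + 8 * (1 + 2 * β) + 2 * γ) ^ 2 *
        ∑ l : Fin N, if l.val ≤ m.val + 1 ∧ m.val ≤ l.val + 1 then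
          (1 + z.1 l ^ (2 * 4) + z.1 l ^ (2 * 2) + z.2 l ^ (2 * 2)) else 0 := by
  set K : ℝ := ω₂ + 2 * lam + 8 * (1 + 2 * β) + 2 * γ with hK
  set W : ℝ := ∑ l : Fin N, if l.val ≤ m.val + 1 ∧ m.val ≤ l.val + 1 then (1 + z.1 l ^ 2) else 0 with hW
  set D : ℝ := ∑ l : Fin N, if l.val ≤ m.val + 1 ∧ m.val ≤ l.val + 1 then (|z.1 l| + |z.2 l|) else 0 with hD
  have h := abs_drift_snd_le_local hω hl hβ hγ z m
  have h8 : ∀ u v : ℝ, 0 ≤ u → 0 ≤ v → (u + v) ^ 4 ≤ 8 * (u ^ 4 + v ^ 4) := fun u v hu hv => by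
    nlinarith [sq_nonneg (u - v), sq_nonneg (u + v), sq_nonneg (u ^ 2 - v ^ 2), sq_nonneg (u ^ 2 + v ^ 2),
      mul_nonneg (sq_nonneg (u - v)) (sq_nonneg (u + v))]
  have hW4 : W ^ 4 ≤ 81 * ∑ l : Fin N, if l.val ≤ m.val + 1 ∧ m.val ≤ l.val + 1 then (1 + z.1 l ^ 2) ^ 4 else 0 := by
    have h1 := pow_nbrSum_le m (θ := fun l => 1 + z.1 l ^ 2) (fun l => by positivity) 4
    norm_num at h1
    exact h1
  have hD4 : D ^ 4 ≤ 81 * ∑ l : Fin N, if l.val ≤ m.val + 1 ∧ m.val ≤ l.val + 1 then (|z.1 l| + |z.2 l|) ^ 4 else 0 := by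
    have h1 := pow_nbrSum_le m (θ := fun l => |z.1 l| + |z.2 l|) (fun l => by positivity) 4
    norm_num at h1
    exact h1
  have hW4' : (∑ l : Fin N, if l.val ≤ m.val + 1 ∧ m.val ≤ l.val + 1 then (1 + z.1 l ^ 2) ^ 4 else 0) ≤
      ∑ l : Fin N, if l.val ≤ m.val + 1 ∧ m.val ≤ l.val + 1 then 8 * (1 + z.1 l ^ (2 * 4)) else 0 := by
    refine Finset.sum_le_sum fun l _ => ?_
    split_ifs
    · have h1 := h8 1 (z.1 l ^ 2) zero_le_one (sq_nonneg _)
      rw [one_pow, ← pow_mul] at h1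
      exact h1
    · exact le_rfl
  have hD4' : (∑ l : Fin N, if l.val ≤ m.val + 1 ∧ m.val ≤ l.val + 1 then (|z.1 l| + |z.2 l|) ^ 4 else 0) ≤
      ∑ l : Fin N, if l.val ≤ m.val + 1 ∧ m.val ≤ l.val + 1 then 8 * (z.1 l ^ (2 * 2) + z.2 l ^ (2 * 2)) else 0 := by
    refine Finset.sum_le_sum fun l _ => ?_
    split_ifs
    · have h1 := h8 |z.1 l| |z.2 l| (abs_nonneg _) (abs_nonneg _)
      have e1 : |z.1 l| ^ 4 = z.1 l ^ (2 * 2) := by rw [pow_mul, ← sq_abs (z.1 l), ← pow_mul]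
      have e2 : |z.2 l| ^ 4 = z.2 l ^ (2 * 2) := by rw [pow_mul, ← sq_abs (z.2 l), ← pow_mul]
      rw [e1, e2] at h1
      exact h1
    · exact le_rfl
  have hY : ((pinnedChain ω₂ lam β γ).drift N z).2 m ^ 2 ≤ (K * W * D) ^ 2 := by
    rw [← sq_abs]
    exact pow_le_pow_left₀ (abs_nonneg _) h 2
  have hWD : (K * W * D) ^ 2 ≤ K ^ 2 * ((W ^ 4 + D ^ 4) / 2) := by
    have h1 : W ^ 2 * D ^ 2 ≤ (W ^ 4 + D ^ 4) / 2 := by nlinarith [sq_nonneg (W ^ 2 - D ^ 2)]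
    calc (K * W * D) ^ 2 = K ^ 2 * (W ^ 2 * D ^ 2) := by ring
      _ ≤ _ := mul_le_mul_of_nonneg_left h1 (sq_nonneg K)
  have hsum : 81 * (∑ l : Fin N, if l.val ≤ m.val + 1 ∧ m.val ≤ l.val + 1 then 8 * (1 + z.1 l ^ (2 * 4)) else 0) +
      81 * (∑ l : Fin N, if l.val ≤ m.val + 1 ∧ m.val ≤ l.val + 1 then 8 * (z.1 l ^ (2 * 2) + z.2 l ^ (2 * 2)) else 0) =
      648 * ∑ l : Fin N, if l.val ≤ m.val + 1 ∧ m.val ≤ l.val + 1 then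
        (1 + z.1 l ^ (2 * 4) + z.1 l ^ (2 * 2) + z.2 l ^ (2 * 2)) else 0 := by
    rw [← mul_add, ← Finset.sum_add_distrib, Finset.mul_sum, Finset.mul_sum]
    refine Finset.sum_congr rfl fun l _ => ?_
    split_ifs <;> ring
  calc ((pinnedChain ω₂ lam β γ).drift N z).2 m ^ 2 ≤ (K * W * D) ^ 2 := hY
    _ ≤ K ^ 2 * ((W ^ 4 + D ^ 4) / 2) := hWD
    _ ≤ K ^ 2 * ((81 * (∑ l : Fin N, if l.val ≤ m.val + 1 ∧ m.val ≤ l.val + 1 then 8 * (1 + z.1 l ^ (2 * 4)) else 0) +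
        81 * (∑ l : Fin N, if l.val ≤ m.val + 1 ∧ m.val ≤ l.val + 1 then
          8 * (z.1 l ^ (2 * 2) + z.2 l ^ (2 * 2)) else 0)) / 2) := by
        gcongr K ^ 2 * ((?_ + ?_) / 2)
        · exact hW4.trans (mul_le_mul_of_nonneg_left hW4' (by norm_num))
        · exact hD4.trans (mul_le_mul_of_nonneg_left hD4' (by norm_num))
    _ = 324 * K ^ 2 * ∑ l : Fin N, if l.val ≤ m.val + 1 ∧ m.val ≤ l.val + 1 then
          (1 + z.1 l ^ (2 * 4) + z.1 l ^ (2 * 2) + z.2 l ^ (2 * 2)) else 0 := by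
        rw [hsum]; ring

/-- **`N`-uniform second Gibbs moment of the momentum drift.**  With the factorial Gibbs moments of helper 8: for every `N`,
every site `m`, `Y_{p,m}² ∈ L¹(μ_T^N)` and `∫ Y_{p,m}² dμ_T^N ≤ 972 (K₁ + 2γ)² (1 + C(4A)⁴ + 2C(2A)²)`. -/
theorem integral_drift_snd_sq_le (hω : 0 < ω₂) (hl : 0 ≤ lam) (hβ : 0 ≤ β) (hγ : 0 ≤ γ) {T : ℝ} (hT : 0 < T) {C A : ℝ}
    (hmom : ∀ (N : ℕ) (i : Fin N) (k : ℕ),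
      Integrable (fun x : PhaseSpace N => x.1 i ^ (2 * k)) ((pinnedChain ω₂ lam β γ).gibbsMeasure N T) ∧
      ∫ x, x.1 i ^ (2 * k) ∂((pinnedChain ω₂ lam β γ).gibbsMeasure N T) ≤ C * (A * k) ^ k ∧
      Integrable (fun x : PhaseSpace N => x.2 i ^ (2 * k)) ((pinnedChain ω₂ lam β γ).gibbsMeasure N T) ∧
      ∫ x, x.2 i ^ (2 * k) ∂((pinnedChain ω₂ lam β γ).gibbsMeasure N T) ≤ C * (A * k) ^ k)
    (N : ℕ) (m : Fin N) :
    Integrable (fun z => ((pinnedChain ω₂ lam β γ).drift N z).2 m ^ 2) ((pinnedChain ω₂ lam β γ).gibbsMeasure N T) ∧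
    ∫ z, ((pinnedChain ω₂ lam β γ).drift N z).2 m ^ 2 ∂((pinnedChain ω₂ lam β γ).gibbsMeasure N T) ≤
      972 * (ω₂ + 2 * lam + 8 * (1 + 2 * β) + 2 * γ) ^ 2 * (1 + C * (A * 4) ^ 4 + 2 * (C * (A * 2) ^ 2)) := by
  set P := pinnedChain ω₂ lam β γ with hP
  set μ := P.gibbsMeasure N T with hμ
  haveI : IsProbabilityMeasure μ := pinnedChain_isProbabilityMeasure_gibbsMeasure hω hl hβ γ N hT
  set K : ℝ := ω₂ + 2 * lam + 8 * (1 + 2 * β) + 2 * γ with hK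
  set B : ℝ := 1 + C * (A * 4) ^ 4 + 2 * (C * (A * 2) ^ 2) with hB
  set g : Fin N → PhaseSpace N → ℝ := fun l z => 1 + z.1 l ^ (2 * 4) + z.1 l ^ (2 * 2) + z.2 l ^ (2 * 2) with hg
  have hgi : ∀ l, Integrable (g l) μ ∧ ∫ z, g l z ∂μ ≤ B := by
    intro l
    obtain ⟨i8, h8, -, -⟩ := hmom N l 4
    obtain ⟨i4, h4, j4, k4⟩ := hmom N l 2
    have h8' : ∫ z, z.1 l ^ (2 * 4) ∂μ ≤ C * (A * 4) ^ 4 := by simpa using h8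
    have h4' : ∫ z, z.1 l ^ (2 * 2) ∂μ ≤ C * (A * 2) ^ 2 := by simpa using h4
    have k4' : ∫ z, z.2 l ^ (2 * 2) ∂μ ≤ C * (A * 2) ^ 2 := by simpa using k4
    have i1 : Integrable (fun z : PhaseSpace N => (1:ℝ) + z.1 l ^ (2 * 4)) μ := (integrable_const 1).add i8
    have i2 : Integrable (fun z : PhaseSpace N => (1:ℝ) + z.1 l ^ (2 * 4) + z.1 l ^ (2 * 2)) μ := i1.add i4
    refine ⟨i2.add j4, ?_⟩
    have e : ∫ z, g l z ∂μ = 1 + ∫ z, z.1 l ^ (2 * 4) ∂μ + ∫ z, z.1 l ^ (2 * 2) ∂μ + ∫ z, z.2 l ^ (2 * 2) ∂μ := by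
      simp only [hg]
      rw [integral_add i2 j4, integral_add i1 i4, integral_add (integrable_const 1) i8, integral_const, smul_eq_mul,
        mul_one, probReal_univ]
    rw [e, hB]
    linarith
  have hg0 : ∀ l z, 0 ≤ g l z := fun l z => by
    have h1 := pow_nonneg' (z.1 l) 4
    have h2 := pow_nonneg' (z.1 l) 2
    have h3 := pow_nonneg' (z.2 l) 2
    simp only [hg]
    linarith
  have hB0 : 0 ≤ B := by
    obtain ⟨-, hle⟩ := hgi m
    have : 0 ≤ ∫ z, g m z ∂μ := integral_nonneg fun z => hg0 m z
    linarith
  -- the majorant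
  have hmaj_int : ∀ l, Integrable (fun z => if l.val ≤ m.val + 1 ∧ m.val ≤ l.val + 1 then g l z else 0) μ := by
    intro l
    by_cases hc : l.val ≤ m.val + 1 ∧ m.val ≤ l.val + 1
    · simp only [hc, and_self, if_true]; exact (hgi l).1
    · simp only [hc, if_false]; exact integrable_const 0
  have hGint : Integrable (fun z => 324 * K ^ 2 * ∑ l : Fin N,
      (if l.val ≤ m.val + 1 ∧ m.val ≤ l.val + 1 then g l z else 0)) μ :=
    (integrable_finsetSum _ fun l _ => hmaj_int l).const_mul _
  have hYc : Continuous fun z => (P.drift N z).2 m :=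
    (continuous_apply m).comp (continuous_snd.comp (pinnedChain_contDiff_drift ω₂ lam β γ N (n := 0)).continuous)
  have hpt : ∀ z, (P.drift N z).2 m ^ 2 ≤ 324 * K ^ 2 * ∑ l : Fin N,
      (if l.val ≤ m.val + 1 ∧ m.val ≤ l.val + 1 then g l z else 0) := fun z =>
    drift_snd_sq_le_local hω.le hl hβ hγ z m
  have hint : Integrable (fun z => (P.drift N z).2 m ^ 2) μ :=
    hGint.mono' (hYc.pow 2).aestronglyMeasurable (ae_of_all _ fun z => by
      rw [Real.norm_eq_abs, abs_of_nonneg (sq_nonneg _)]; exact hpt z)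
  refine ⟨hint, (integral_mono hint hGint hpt).trans ?_⟩
  rw [integral_const_mul, integral_finsetSum _ fun l _ => hmaj_int l]
  have hterm : ∀ l : Fin N, l.val ≤ m.val + 1 ∧ m.val ≤ l.val + 1 →
      ∫ z, (if l.val ≤ m.val + 1 ∧ m.val ≤ l.val + 1 then g l z else 0) ∂μ ≤ B := by
    intro l hl'
    simp only [hl', and_self, if_true]
    exact (hgi l).2
  have hs := sum_nbr_le m hB0 (a := fun l => ∫ z, (if l.val ≤ m.val + 1 ∧ m.val ≤ l.val + 1 then g l z else 0) ∂μ) hterm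
  have e2 : (∑ l : Fin N, ∫ z, (if l.val ≤ m.val + 1 ∧ m.val ≤ l.val + 1 then g l z else 0) ∂μ) =
      ∑ l : Fin N, (if l.val ≤ m.val + 1 ∧ m.val ≤ l.val + 1 then
        ∫ z, (if l.val ≤ m.val + 1 ∧ m.val ≤ l.val + 1 then g l z else 0) ∂μ else 0) := by
    refine Finset.sum_congr rfl fun l _ => ?_
    by_cases hc : l.val ≤ m.val + 1 ∧ m.val ≤ l.val + 1
    · simp only [hc, and_self, if_true]
    · simp only [hc, if_false, integral_zero]
  rw [e2]
  have hK2 : 0 ≤ 324 * K ^ 2 := by positivity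
  calc 324 * K ^ 2 * ∑ l : Fin N, (if l.val ≤ m.val + 1 ∧ m.val ≤ l.val + 1 then
        ∫ z, (if l.val ≤ m.val + 1 ∧ m.val ≤ l.val + 1 then g l z else 0) ∂μ else 0)
      ≤ 324 * K ^ 2 * (3 * B) := mul_le_mul_of_nonneg_left hs hK2
    _ = 972 * K ^ 2 * B := by ring

/-! ### Jensen in time, Tonelli and stationarity -/

/-- **Second moment of a time integral along the stationary flow.**  For continuous `g ≥ 0` with `∫ g² dμ_T ≤ M` and
`t ≥ 0`: `∫⁻ (∫₀ᵗ g(Φ_r(x, Bω)) dr)² d(μ_T ⊗ W) ≤ t² M`. -/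
theorem lintegral_sq_timeIntegral_comp_solMap_le (hω : 0 < ω₂) (hl : 0 ≤ lam) (hβ : 0 ≤ β) (hγ : 0 ≤ γ) (N : ℕ)
    (hN : 0 < N) {T : ℝ} (hT : 0 < T) {g : PhaseSpace N → ℝ} (hgc : Continuous g) (hg0 : ∀ z, 0 ≤ g z) {M : ℝ}
    (hgM : Integrable (fun y => g y ^ 2) ((pinnedChain ω₂ lam β γ).gibbsMeasure N T) ∧
      ∫ y, g y ^ 2 ∂((pinnedChain ω₂ lam β γ).gibbsMeasure N T) ≤ M) {t : ℝ} (ht : 0 ≤ t) :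
    ∫⁻ q, ENNReal.ofReal ((∫ r in (0:ℝ)..t, g ((pinnedChain ω₂ lam β γ).solMap N T T r q.1 (pairPath q.2))) ^ 2)
        ∂(((pinnedChain ω₂ lam β γ).gibbsMeasure N T).prod wienerPair) ≤ ENNReal.ofReal (t ^ 2 * M) := by
  -- adapted from `lintegral_timeIntegral_momentum_sq_pow_le` (helper 9)
  set P := pinnedChain ω₂ lam β γ with hP
  set π := (P.gibbsMeasure N T).prod wienerPair with hπ
  haveI : IsProbabilityMeasure (P.gibbsMeasure N T) := pinnedChain_isProbabilityMeasure_gibbsMeasure hω hl hβ γ N hT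
  haveI : SFinite π := by rw [hπ]; infer_instance
  set p : ℝ → PhaseSpace N × WienerPair → ℝ := fun r q => g (P.solMap N T T r q.1 (pairPath q.2)) with hp
  have hpc : ∀ q, Continuous fun r => p r q := fun q =>
    hgc.comp (pinnedChain_continuous_solMap hω hl hβ hγ N T T q.1 (pairPath q.2))
  have hpm : Measurable fun qr : (PhaseSpace N × WienerPair) × ℝ => ENNReal.ofReal (p qr.2 qr.1 ^ 2) := by
    have h1 := pinnedChain_measurable_solMap_pairPath_uncurry_swap hω hl hβ hγ N T T
    exact ((hgc.measurable.comp h1).pow_const 2).ennreal_ofReal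
  have hJ : ∀ q, (∫ r in (0:ℝ)..t, p r q) ^ 2 ≤ t * ∫ r in (0:ℝ)..t, p r q ^ 2 := by
    intro q
    have h := pow_intervalIntegral_le' (f := fun r => p r q) (hpc q) (fun r => hg0 _) ht (n := 2) (by norm_num)
    simpa using h
  have hofReal : ∀ q, ENNReal.ofReal (∫ r in (0:ℝ)..t, p r q ^ 2) = ∫⁻ r in Ioc 0 t, ENNReal.ofReal (p r q ^ 2) := by
    intro q
    rw [intervalIntegral.integral_of_le ht]
    exact ofReal_integral_eq_lintegral_ofReal (((hpc q).pow 2).integrableOn_Ioc) (ae_of_all _ fun r => sq_nonneg _)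
  have hM0 : 0 ≤ M := le_trans (integral_nonneg fun y => sq_nonneg _) hgM.2
  have hstat : ∀ r, ∫⁻ q, ENNReal.ofReal (p r q ^ 2) ∂π ≤ ENNReal.ofReal M := by
    intro r
    have h := pinnedChain_lintegral_prod_solMap_gibbs hω hl hβ hγ N hN hT r
      (g := fun y => ENNReal.ofReal (g y ^ 2)) ((hgc.measurable.pow_const 2).ennreal_ofReal)
    calc ∫⁻ q, ENNReal.ofReal (p r q ^ 2) ∂π = ∫⁻ y, ENNReal.ofReal (g y ^ 2) ∂(P.gibbsMeasure N T) := h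
      _ = ENNReal.ofReal (∫ y, g y ^ 2 ∂(P.gibbsMeasure N T)) :=
          (ofReal_integral_eq_lintegral_ofReal hgM.1 (ae_of_all _ fun y => sq_nonneg _)).symm
      _ ≤ ENNReal.ofReal M := ENNReal.ofReal_le_ofReal hgM.2
  calc ∫⁻ q, ENNReal.ofReal ((∫ r in (0:ℝ)..t, p r q) ^ 2) ∂π
      ≤ ∫⁻ q, (ENNReal.ofReal t * ∫⁻ r in Ioc 0 t, ENNReal.ofReal (p r q ^ 2)) ∂π := by
        refine lintegral_mono fun q => ?_
        rw [← hofReal, ← ENNReal.ofReal_mul ht]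
        exact ENNReal.ofReal_le_ofReal (hJ q)
    _ = ENNReal.ofReal t * ∫⁻ r in Ioc 0 t, ∫⁻ q, ENNReal.ofReal (p r q ^ 2) ∂π := by
        rw [lintegral_const_mul _ (hpm.lintegral_prod_right'), lintegral_lintegral_swap hpm.aemeasurable]
    _ ≤ ENNReal.ofReal t * ∫⁻ _r in Ioc 0 t, ENNReal.ofReal M :=
        mul_le_mul' le_rfl (lintegral_mono fun r => hstat r)
    _ = ENNReal.ofReal (t ^ 2 * M) := by
        rw [setLIntegral_const, Real.volume_Ioc, sub_zero, ← ENNReal.ofReal_mul hM0, ← ENNReal.ofReal_mul ht]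
        congr 1
        ring

/-! ### The driving noise of one site -/

/-- **Second moment of the noise increment of one site**: `∫⁻ η_m(s)² d(μ_T ⊗ W) ≤ 8 γ T s` for `s ≥ 0`
(`η_m = [m=0] √(2γT) B¹ + [m=N−1] √(2γT) B²`, `E B_s² = s`). -/
theorem lintegral_pairNoise_sq_le (hγ : 0 ≤ γ) (N : ℕ) {T : ℝ} (hT : 0 ≤ T) (μ : Measure (PhaseSpace N))
    [IsProbabilityMeasure μ] (m : Fin N) {s : ℝ} (hs0 : 0 ≤ s) :
    ∫⁻ q, ENNReal.ofReal (((pinnedChain ω₂ lam β γ).pairNoise N T T (pairPath q.2) s m) ^ 2) ∂(μ.prod wienerPair) ≤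
      ENNReal.ofReal (8 * γ * T * s) := by
  set P := pinnedChain ω₂ lam β γ with hP
  set c : ℝ := Real.sqrt (2 * P.γ * T) with hc
  have hPγ : P.γ = γ := rfl
  have hc2 : c ^ 2 = 2 * γ * T := by rw [hc, Real.sq_sqrt (by rw [hPγ]; positivity), hPγ]
  set sN : ℝ≥0 := s.toNNReal with hsN
  have hsNs : (sN : ℝ) = s := Real.coe_toNNReal _ hs0
  set F : WienerPair → ℝ := fun ω => 2 * c ^ 2 * brownian sN ω.1 ^ 2 + 2 * c ^ 2 * brownian sN ω.2 ^ 2 with hF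
  -- pointwise
  have hpt : ∀ ω : WienerPair, (P.pairNoise N T T (pairPath ω) s m) ^ 2 ≤ F ω := by
    intro ω
    rw [P.pairNoise_pairPath]
    set a : ℝ := if m.val = 0 then Real.sqrt (2 * P.γ * T) else 0 with ha
    set b : ℝ := if m.val = N - 1 then Real.sqrt (2 * P.γ * T) else 0 with hb
    have ha2 : a ^ 2 ≤ c ^ 2 := by
      rw [ha]; split_ifs
      · exact le_rfl
      · simp [sq_nonneg]
    have hb2 : b ^ 2 ≤ c ^ 2 := by
      rw [hb]; split_ifs
      · exact le_rfl
      · simp [sq_nonneg]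
    have hsn : s.toNNReal = sN := rfl
    rw [hsn]
    set u := brownian sN ω.1
    set v := brownian sN ω.2
    calc (a * u + b * v) ^ 2 ≤ 2 * (a ^ 2 * u ^ 2) + 2 * (b ^ 2 * v ^ 2) := by nlinarith [sq_nonneg (a * u - b * v)]
      _ ≤ 2 * (c ^ 2 * u ^ 2) + 2 * (c ^ 2 * v ^ 2) := by
          gcongr
      _ = F ω := by simp only [hF]; ring
  -- integrate
  have hFi : Integrable F wienerPair :=
    ((integrable_brownian_fst_pow sN 2).const_mul _).add ((integrable_brownian_snd_pow sN 2).const_mul _)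
  have hF0 : ∀ ω, 0 ≤ F ω := fun ω => by simp only [hF]; positivity
  have hFval : ∫ ω, F ω ∂wienerPair = 4 * c ^ 2 * s := by
    simp only [hF]
    rw [integral_add ((integrable_brownian_fst_pow sN 2).const_mul _) ((integrable_brownian_snd_pow sN 2).const_mul _),
      integral_const_mul, integral_const_mul, integral_brownian_fst_sq, integral_brownian_snd_sq, hsNs]
    ring
  have hFm : Measurable fun ω : WienerPair => ENNReal.ofReal (F ω) := by
    have h1 : Measurable fun ω : WienerPair => brownian sN ω.1 := (measurable_brownian sN).comp measurable_fst
    have h2 : Measurable fun ω : WienerPair => brownian sN ω.2 := (measurable_brownian sN).comp measurable_snd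
    simp only [hF]
    exact ((((h1.pow_const 2).const_mul _)).add ((h2.pow_const 2).const_mul _)).ennreal_ofReal
  have hm2 : Measurable fun q : PhaseSpace N × WienerPair => ENNReal.ofReal (F q.2) := hFm.comp measurable_snd
  calc ∫⁻ q, ENNReal.ofReal ((P.pairNoise N T T (pairPath q.2) s m) ^ 2) ∂(μ.prod wienerPair)
      ≤ ∫⁻ q, ENNReal.ofReal (F q.2) ∂(μ.prod wienerPair) := lintegral_mono fun q => ENNReal.ofReal_le_ofReal (hpt q.2)
    _ = ∫⁻ _x, ∫⁻ ω, ENNReal.ofReal (F ω) ∂wienerPair ∂μ := lintegral_prod _ hm2.aemeasurable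
    _ = ∫⁻ ω, ENNReal.ofReal (F ω) ∂wienerPair := by rw [lintegral_const, measure_univ, mul_one]
    _ = ENNReal.ofReal (∫ ω, F ω ∂wienerPair) := (ofReal_integral_eq_lintegral_ofReal hFi (ae_of_all _ hF0)).symm
    _ = ENNReal.ofReal (8 * γ * T * s) := by rw [hFval, hc2]; ring_nf

/-- **Registered helper `helper_kdDriftSecondMoment` (stub S, line `kick-dipole-no-collapse`): `N`-UNIFORM SECOND GIBBS MOMENT OF
THE MOMENTUM DRIFT** (closed form of `integral_drift_snd_sq_le` with the factorial Gibbs moments of helper 8 inlined): one constant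
`C_Y` bounds `∫ Y_{p,m}² dμ_T^N` for every `N` and every site `m`. -/
theorem helper_kdDriftSecondMoment : ∀ ω₂ lam β γ : ℝ, 0 < ω₂ → 0 ≤ lam → 0 ≤ β → 0 ≤ γ → ∀ T : ℝ, 0 < T → ∃ CY : ℝ, 0 ≤ CY ∧ ∀ (N : ℕ) (m : Fin N), Integrable (fun z => ((pinnedChain ω₂ lam β γ).drift N z).2 m ^ 2) ((pinnedChain ω₂ lam β γ).gibbsMeasure N T) ∧ ∫ z, ((pinnedChain ω₂ lam β γ).drift N z).2 m ^ 2 ∂((pinnedChain ω₂ lam β γ).gibbsMeasure N T) ≤ CY := by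
  intro ω₂ lam β γ hω hl hβ hγ T hT
  obtain ⟨C, A, hC1, hA0, hmom⟩ := helper_kdGibbsFactorialMoments ω₂ lam β γ hω hl hβ T hT
  have hC0 : 0 ≤ C := zero_le_one.trans hC1
  refine ⟨972 * (ω₂ + 2 * lam + 8 * (1 + 2 * β) + 2 * γ) ^ 2 * (1 + C * (A * 4) ^ 4 + 2 * (C * (A * 2) ^ 2)), by positivity,
    fun N m => integral_drift_snd_sq_le hω hl hβ hγ hT hmom N m⟩

end Summit.AtomisticToContinuum.FouriersLaw.Cruxes.ConductanceLowerBound.KickDipoleNoCollapse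

end
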